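import Summits.NavierStokesRegularity.OSWSelfSimilar.SheetRSpectrumOddAssembly
import Summits.NavierStokesRegularity.OSWSelfSimilar.SheetREvansFarField
import Summits.NavierStokesRegularity.OSWSelfSimilar.SheetRWeakEigenReal
import HarnessLib

/-!
# SHEET-ℝ frame, Z3-SR-SPEC S2 — the KERNEL ASSEMBLY on the odd class with REAL DATA and the hypotheses in their DISCHARGEABLE forms:
# (S1) datum · impl-2's rectangle label certificate · far-field chain + ONE literal inequality · ONE real weak equation for the gauge mode

HONEST FRAMING (cell ns-blowup GROUP B / zone Z3, case Z3-SR-SPEC, steps (S1)/(S2) and P-list (P2)/(P3)/(P5)/(P6); 1-D MODEL certificate frame (viscous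
gCLM/OSW sheet on the line); computer-assisted; not Euler/NS; «violates: none — MODEL»). NOTHING here is interval arithmetic and NOTHING asserts that the
hypotheses hold: `h` is the (S1) Gårding datum; `RectLabelCertificate …` is implementation 2's (S2) certificate (cert-2 g7); the far field enters as the
resolvent-only chain `a₀ = f, a_j = R_K(z)(a_{j+1} + z a_j)` plus ONE literal inequality (row B of `CertificateViscousSheetRSpectrumB`); the gauge mode
enters as ONE REAL weak equation for a real energy-space element `p ≠ 0` (cert-5's (P6) transport `SheetRTimeShiftModeWeak`).  Refines
`SheetRSpectrumOddAssembly.weakEigen_set_eq_singleton` by `SheetREvansFarField.evansOdd_ne_zero_of_farField` and `SheetRWeakEigenReal.isWeakEigen_of_real`: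

* `inner_ofRealW` — `⟪h + 0i, u + 0i⟫_ℂ = ⟪h, u⟫_ℝ` (so `ℓ = ⟪h + 0i, ·⟫` is real on real classes: `im_inner_ofRealW_cplx`, `re_inner_ofRealW_cplx`);
* `realOdd fR hf : Wcodd L` — the complex class `f_R + 0i` of an odd real `f_R ∈ Wodd L`;
* **`weakEigen_set_eq_singleton_real`** — with `ℓ := ⟪h_R + 0i, ·⟫ ∘ subtype`, `f := f_R + 0i`, real `θ`:
  `{σ : Re σ > −3/100 ∧ ∃ u ≠ 0, IsWeakEigen … σ u} = {1}`, and **`weakEigen_one_simple_real`** (simplicity at `σ = 1`).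
In the cell's dictionary: `h_R = f_R = v₀`, `θ = 4`, `K = −P* + F′` with `F′q = θ⟪v₀, ιE q⟫_w v₀`, so `A − θℓ(·)f = DG(Ω*)` and the conclusion is the PREREG PASS
word «σ_p(−DG(Ω*)|odd) ∩ {Re σ > −3/100} = {1}, simple» MODULO: the (S1) datum, `RectLabelCertificate`, the four far-field literals, and the real weak
gauge-mode identity.  Pure composition; one auxiliary definition (`realOdd`); no named fact; no number of record moves.  WHAT THIS IS NOT: not NS.
-/

noncomputable section

namespace Summit.NavierStokesRegularity.OSWSelfSimilar
namespace SheetRSpectrumOddAssemblyReal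

open _root_.MeasureTheory _root_.Set _root_.Filter _root_.Real SheetRWeakProfilePV SheetRWeakToStrong SheetREnergyClass SheetRWeightedMeasure
  SheetRLinearisedTests SheetREnergySpace SheetRTestSpace SheetRLinearisedFormBounds SheetRSolutionOperator SheetRLinearisedCutoffEnergy
  SheetRResolventPair SheetRComplexPivot SheetRResolventComplex SheetRResolventIdentity SheetRPerturbedUniqueness SheetRPerturbedPair
  SheetRPerturbedResolventC SheetRPerturbedResolventIdentityC SheetROddClass SheetRResolventOddClass SheetRGeneratorOddWeak SheetREvansOdd
  SheetRSpectrumWindingLists SheetRSpectrumOddAssembly SheetREvansFarField SheetREnergySpaceOf SheetRPerturbedSolutionOperator SheetRWeakEigenReal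
  Literature.Analysis.OperatorTheory Complex
open scoped Topology ENNReal InnerProductSpace

variable {L D₀ D₁ V₀ c m : ℝ} {d V : ℝ → ℝ}

/-! ### §1 Real vectors and real functionals in `L²_w(ℂ)` -/

/-- **`⟪h + 0i, u + 0i⟫_ℂ = ⟪h, u⟫_ℝ`.** [folklore] -/
theorem inner_ofRealW (h u : W L) : ⟪ofRealW L h, ofRealW L u⟫_ℂ = ((⟪h, u⟫_ℝ : ℝ) : ℂ) := by
  rw [L2.inner_def, L2.inner_def, ← integral_complex_ofReal]
  refine integral_congr_ae ?_
  filter_upwards [ofRealW_ae h, ofRealW_ae u] with y hh hu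
  rw [hh, hu, RCLike.inner_apply, RCLike.inner_apply, Complex.conj_ofReal, conj_trivial, Complex.ofReal_mul]

/-- The functional `⟪h_R + 0i, ·⟫` is REAL on the complex class of a real energy-space element: imaginary part `0`, real part `⟪h_R, ιE p⟫_ℝ`. [folklore] -/
theorem re_im_inner_ofRealW_cplx (hL : 0 < L) (hR : W L) (p : Esp L hL) :
    ((((innerSL ℂ (ofRealW L hR)).comp (Wcodd L).subtypeL) (cplx hL p)).re = ⟪hR, ιE hL p⟫_ℝ) ∧
      (((innerSL ℂ (ofRealW L hR)).comp (Wcodd L).subtypeL) (cplx hL p)).im = 0 := by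
  rw [ContinuousLinearMap.comp_apply, Submodule.subtypeL_apply, coe_cplx, innerSL_apply_apply, inner_ofRealW]
  exact ⟨Complex.ofReal_re _, Complex.ofReal_im _⟩

/-- `f_R + 0i ∈ Wcodd L` for an odd real `f_R`. [folklore] -/
theorem ofRealW_mem_Wcodd {fR : W L} (hf : fR ∈ Wodd L) : ofRealW L fR ∈ Wcodd L := by
  rw [← (ofPair_inlW fR).1]
  refine ofPair_mem_Wcodd L ?_ ?_
  · rw [(inlW_fst_snd fR).1]; exact hf
  · rw [(inlW_fst_snd fR).2]; exact (Wodd L).zero_mem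

/-- **The complex class `f_R + 0i ∈ Wcodd L` of an odd real `f_R`.** [folklore] -/
def realOdd (fR : W L) (hf : fR ∈ Wodd L) : Wcodd L := ⟨ofRealW L fR, ofRealW_mem_Wcodd hf⟩

/-- Coercion of `realOdd`. [folklore] -/
theorem coe_realOdd (fR : W L) (hf : fR ∈ Wodd L) : (realOdd fR hf : Wc L) = ofRealW L fR := rfl

/-! ### §2 The assembly with real data and dischargeable hypotheses -/

section Assembly

variable (hL : 0 < L) (K : Esp L hL →L[ℝ] W L) (h : GardingDataKC L hL d V K D₀ D₁ V₀ c m) (hm : -m < ra)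
  (hR fR : W L) (hf : fR ∈ Wodd L) (θ : ℝ)
  (hcert : RectLabelCertificate (evansOdd hL K h ((innerSL ℂ (ofRealW L hR)).comp (Wcodd L).subtypeL) (realOdd fR hf) θ))
  {z : ℂ} (hz : -m < z.re) {a : ℕ → Wc L} (ha0 : a 0 = ofRealW L fR)
  (hchain : ∀ j < 3, a j = resolventKC hL K h z (a (j + 1) + z • a j))
  (hB : ‖(θ : ℂ)‖ * (‖⟪ofRealW L hR, a 0⟫_ℂ‖ / ((1141 : ℝ) / 100) + ‖⟪ofRealW L hR, a 1⟫_ℂ‖ / ((1141 : ℝ) / 100) ^ 2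
    + (‖⟪ofRealW L hR, a 2⟫_ℂ‖ + ‖ofRealW L hR‖ * ‖a 3‖ / (m + ra)) / ((1141 : ℝ) / 100) ^ 3) < 1)
  {p : Esp L hL} (hp : p ≠ 0)
  (hweak : ∀ v v₁ : ℝ → ℝ, IsCompactTest v v₁ →
    linForm L d V (prim (der p)) (der p) v v₁ + (∫ y, (L ^ 2 + y ^ 2) * (((K p : W L) : ℝ → ℝ) y * v y)) =
      ∫ y, (L ^ 2 + y ^ 2) * ((((θ * ⟪hR, ιE hL p⟫_ℝ) • fR - ιE hL p : W L) : ℝ → ℝ) y * v y))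

include hm hz ha0 hchain hB in
/-- **Far field from the chain and one inequality**: `E(σ) ≠ 0` for `Re σ > −3/100`, `‖σ‖ > 1141/100`. [folklore] -/
theorem farField_real :
    ∀ σ : ℂ, ra < σ.re → (1141 : ℝ) / 100 < ‖σ‖ →
      evansOdd hL K h ((innerSL ℂ (ofRealW L hR)).comp (Wcodd L).subtypeL) (realOdd fR hf) θ σ ≠ 0 := by
  intro σ hσ hnorm
  have hc₀ : 0 < m + ra := by linarith
  exact evansOdd_ne_zero_of_farField hL K h hz (ofRealW L hR) (realOdd fR hf) (θ : ℂ) ha0 hchain hc₀ (by norm_num) hB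
    (by linarith) (by linarith) hnorm.le

include h hweak in
/-- **The gauge mode from one real weak equation**: `cplx p` is a weak eigenvector at `σ = 1`. [folklore] -/
theorem weakEigen_one_real : IsWeakEigen hL K d V ((innerSL ℂ (ofRealW L hR)).comp (Wcodd L).subtypeL) (realOdd fR hf) (θ : ℂ) 1 (cplx hL p) := by
  obtain ⟨hre, him⟩ := re_im_inner_ofRealW_cplx hL hR p
  refine isWeakEigen_of_real hL K h _ (coe_realOdd fR hf) θ p him fun v v₁ hv => ?_
  rw [hre]
  exact hweak v v₁ hv

include hm hcert hz ha0 hchain hB hp hweak in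
/-- **S2 ON THE ODD CLASS WITH REAL DATA.**  The set of `σ` with `Re σ > −3/100` at which `A − θ⟪h_R + 0i, ·⟫(f_R + 0i)` has a non-trivial weak eigenvector
is `{1}` — modulo the (S1) datum, implementation 2's label certificate, the far-field chain + inequality, and the real weak gauge-mode equation. [folklore] -/
theorem weakEigen_set_eq_singleton_real :
    {σ : ℂ | ra < σ.re ∧ ∃ u : Wcodd L, u ≠ 0 ∧
      IsWeakEigen hL K d V ((innerSL ℂ (ofRealW L hR)).comp (Wcodd L).subtypeL) (realOdd fR hf) (θ : ℂ) σ u} = {1} :=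
  weakEigen_set_eq_singleton hL K h hm _ _ _ hcert (farField_real hL K h hm hR fR hf θ hz ha0 hchain hB) (cplx_ne_zero hL hp)
    (weakEigen_one_real hL K h hR fR hf θ hweak)

include hm hcert hp hweak in
/-- **Simplicity at `σ = 1` with real data**: `R_K(1)(f_R + 0i) ≠ 0`, the weak eigenvectors at `1` are its multiples, and no weak Jordan chain exists. [folklore] -/
theorem weakEigen_one_simple_real :
    resolventOdd hL K h 1 (realOdd fR hf) ≠ 0 ∧
      (∀ u : Wcodd L, IsWeakEigen hL K d V ((innerSL ℂ (ofRealW L hR)).comp (Wcodd L).subtypeL) (realOdd fR hf) (θ : ℂ) 1 u ↔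
        ∃ t : ℂ, u = t • resolventOdd hL K h 1 (realOdd fR hf)) ∧
      ∀ δ₀ : Wcodd L, δ₀ ≠ 0 → IsWeakEigen hL K d V ((innerSL ℂ (ofRealW L hR)).comp (Wcodd L).subtypeL) (realOdd fR hf) (θ : ℂ) 1 δ₀ →
        ¬ ∃ δ₁ : Wcodd L, IsWeakJordan hL K d V ((innerSL ℂ (ofRealW L hR)).comp (Wcodd L).subtypeL) (realOdd fR hf) (θ : ℂ) 1 δ₀ δ₁ :=
  weakEigen_one_simple hL K h hm _ _ _ hcert (cplx_ne_zero hL hp) (weakEigen_one_real hL K h hR fR hf θ hweak)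

end Assembly

end SheetRSpectrumOddAssemblyReal
end Summit.NavierStokesRegularity.OSWSelfSimilar

end
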